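import Literature.Computability.Complexity.AdditiveRealClasses
import Literature.Computability.Complexity.Nondeterministic
import HarnessLib

/-!
# Fournier–Koiran 2000: `NDP⁰_ℝovs ⊆ P⁰_ℝovs(NP)` (transfer theorem, sign-oracle rendering)

Topic `Literature/Computability/Complexity`; ONE named fact (result in print, `def … : Prop`,
D-0014) requested by `wi-10260` for route `PneNP/NoTardosTropics` (crux `FKThm3Digital` =
`stmt-PneNP-2564`, "a published theorem to be formalised in this model"), stated over the
classes of `AdditiveRealClasses.lean` (`NDPAdd = NDP⁰_ℝovs`, `PAddRelClass C = P⁰_ℝovs(C)`,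
sign-oracle rendering of Koiran's parameter-free machines over `ℝ_ovs = (ℝ, +, −, <)`), so that
the route decl follows from it by unfolding (`fun _ hL => h hL`; checked in the vendoring seat's
scratch file against the Theses text).

H. Fournier, P. Koiran, *Lower bounds are not easier over the reals: inside PH*, ICALP 2000
(LNCS 1853) = LIP research report RR-1999-21 (held as `paper:galaxy-pdf-1066243140`, read in
full; page numbers below are those of the report):

* **Theorem 3** (p. 10): `NP⁰_ℝovs ⊆ P⁰_ℝovs(NP)` — every real language decided in
  nondeterministic polynomial time by a parameter-free machine over `ℝ_ovs` is decided in
  polynomial time by a parameter-free machine over `ℝ_ovs` with a BOOLEAN `NP` oracle.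
* **Fact 2** (p. 10; Koiran 1994): `NP⁰_ℝovs = NDP⁰_ℝovs`, where `A ∈ NDP⁰_ℝovs` iff there are
  `B ∈ P⁰_ℝovs` and a polynomial `p` with `x ∈ A ⟺ ∃ z ∈ {0,1}^{p(n)}, ⟨x, z⟩ ∈ B` (digital
  nondeterminism). The tree renders only the digital class (`NDPAdd`); with Fact 2 (or the
  trivial inclusion `NDP⁰ ⊆ NP⁰`) Theorem 3 gives `NDP⁰_ℝovs ⊆ P⁰_ℝovs(NP)`, the statement
  vendored here.
* Proof architecture (pp. 4–11, for the record): each test of a time-`t(n)` parameter-free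
  machine is an integer affine form with coefficients bounded by `2^{t(n)}` (Remark 1, p. 5), so
  `L ∩ ℝⁿ` is a union of faces of the arrangement `𝒜(ℋₙ)` of all such hyperplanes;
  **Theorem 2** (p. 4): the location problem for `𝒜(ℋₙ)` is in `FP⁰_ℝovs(NP)` (Meyer auf der
  Heide's recursion made uniform with an `NP` oracle: little cubes of radius `< rₙ`,
  `1/rₙ = n^{n²}2^{2n²t(n)+O(n²)}`, §§2.1–2.4); then membership of the located cell in `L` is one
  Boolean `NP` query (guess the digital certificate and an accepting path, LP feasibility; p. 11).
  **Remark 2** (p. 11): the same method gives `C⁰_ℝovs ⊆ P⁰_ℝovs(C)` for reasonable `C`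
  (`PP`, `Σᵏ`, `PAR/PSPACE`). **Theorem 1** (p. 2): `P⁰_ℝovs = NP⁰_ℝovs ⟺ P = NP`.

## Rendering / scope

* The fact is `NDPAdd ⊆ PAddRelClass Nondeterministic.NP` with the tree's definitions: oracle
  algorithms (`OracleAlg Bool`, polynomial-time step function, polynomial round budget, input
  `unaryEncodeNat n`) whose only access to `x ∈ ℝⁿ` is the sign oracle on integer affine forms
  (`signOracle x`), digital witnesses appended to the Boolean input (`NDPAdd`), and a Boolean
  oracle `A ∈ NP` reached through the tagged oracle `signOracleWith A x` (`PAddRel A`). The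
  adequacy of this rendering with respect to Koiran's machine classes (both directions, up to
  polynomial factors: symbolic simulation of registers by integer affine forms with
  polynomial-bit coefficients, Remark 1; evaluation of a query form by repeated doubling) is
  discussed in the module docstring of `AdditiveRealClasses.lean`; the printed proof of
  Theorem 3 goes through verbatim in the rendering (the verifier's queries have polynomial bit
  size because its step function is polynomial-time and all oracle answers are single bits).
* Not vendored: Theorem 2 as a separate `FP⁰_ℝovs(NP)` statement (it would need a vocabulary of
  locating systems and faces of `𝒜(ℋₙ)`; in the route it is only a step towards Theorem 3 —
  file a definition item if the `Location` rung of the route's two-layer plan is wanted as a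
  separate fact), Theorem 1, Fact 1 (Boolean parts), Remark 2, the completeness results of §3.

## References

* H. Fournier, P. Koiran, *Lower bounds are not easier over the reals: inside PH*, ICALP 2000,
  LNCS 1853, 832–843 = LIP RR-1999-21 (hal-02102035): Thm 1 (p. 2), Thm 2 and Remark 1
  (pp. 4–5), §§2.1–2.4, Fact 1, Fact 2, Thm 3 (p. 10), Remark 2 (p. 11). [`FournierKoiran2000`]
* P. Koiran, *Computing over the reals with addition and order*, Theoret. Comput. Sci. 133
  (1994) 35–47 (Fact 2). [`Koiran1994`]
-/

namespace Literature.Computability.Complexity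

open _root_.Computability

/-- **Fournier–Koiran 2000, Theorem 3 (with Fact 2), sign-oracle rendering:
`NDP⁰_ℝovs ⊆ P⁰_ℝovs(NP)`.** Every real language `L : (n : ℕ) → Set (Fin n → ℝ)` with a
polynomial-time sign-query verifier of polynomially long Boolean witnesses (`L ∈ NDPAdd`) is
decided by a polynomial-time sign-query algorithm with SOME Boolean oracle `A ∈ NP`
(`L ∈ PAddRelClass NP`, i.e. `∃ A ∈ NP, L ∈ PAddRel A`). Printed: "Theorem 3.
`NP⁰_ℝovs ⊆ P⁰_ℝovs(NP)`" (report p. 10), whose proof starts from the digital description of `L`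
given by "Fact 2. `NP⁰_ℝovs = NDP⁰_ℝovs`"; the digital class is the one rendered in the tree, so
the vendored inclusion is the printed theorem restricted along `NDP⁰ ⊆ NP⁰`. The route decl
`Summit.PneNP.PneNP.Theses.NoTardosTropics.FKThm3Digital` is this statement with `NDPAdd`,
`PAddRelClass`, `signOracle`, `signOracleWith` unfolded. Not proved here (Meyer auf der Heide
point location with an `NP` oracle, Thm 2, plus an `NP` cell decision; XL in this model).
[cite: FournierKoiran2000, Thm 3 (report p. 10) with Fact 2] -/
def fournierKoiran2000_NDPAdd_subset_PAddRelClass_NP : Prop :=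
  NDPAdd ⊆ PAddRelClass Nondeterministic.NP

/-- Pointwise form of Fournier–Koiran's Theorem 3 in the rendering (the named fact is the
hypothesis `h`): `L ∈ NDP⁰_ℝovs ⇒ ∃ A ∈ NP, L ∈ P⁰_ℝovs(A)`.
[cite: FournierKoiran2000, Thm 3 (report p. 10)] -/
theorem exists_mem_NP_mem_PAddRel_of_mem_NDPAdd
    (h : fournierKoiran2000_NDPAdd_subset_PAddRelClass_NP) {L : RealLanguage}
    (hL : L ∈ NDPAdd) : ∃ A ∈ Nondeterministic.NP, L ∈ PAddRel A :=
  h hL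

/-- **Unfolded form** (the shape of the route crux `FKThm3Digital`, in the tree's names): from a
polynomial-time sign-query verifier `M` with witness/round polynomial `q` for `L`, Theorem 3
yields a Boolean `A ∈ NP`, a polynomial-time oracle algorithm `M'` and a polynomial `q'` with
`M'.run (signOracleWith A x) (q' n) (unaryEncodeNat n) = some [x ∈ L n]` for all `n`, `x`.
PROVED from the fact by unfolding `NDPAdd` / `PAddRelClass` / `PAddRel`.
[cite: FournierKoiran2000, Thm 3 (report p. 10) with Fact 2] -/
theorem fournierKoiran2000_transfer_unfolded
    (h : fournierKoiran2000_NDPAdd_subset_PAddRelClass_NP) (L : (n : ℕ) → Set (Fin n → ℝ))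
    (hL : ∃ M : OracleAlg Bool, M.IsPolyTime encodingBoolBool ∧ ∃ q : Polynomial ℕ,
      ∀ (n : ℕ) (x : Fin n → ℝ),
        ((x ∈ L n) ↔ ∃ y : List Bool, y.length ≤ q.eval n ∧
          M.run (signOracle x) (q.eval n) (boolPair (unaryEncodeNat n) y) = some true)) :
    ∃ A : Language Bool, A ∈ Nondeterministic.NP ∧ ∃ M : OracleAlg Bool,
      M.IsPolyTime encodingBoolBool ∧ ∃ q : Polynomial ℕ, ∀ (n : ℕ) (x : Fin n → ℝ),
        M.run (signOracleWith A x) (q.eval n) (unaryEncodeNat n) =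
          some (@decide (x ∈ L n) (Classical.dec _)) := by
  obtain ⟨A, hA, hLA⟩ := h (show L ∈ NDPAdd from hL)
  exact ⟨A, hA, hLA⟩

end Literature.Computability.Complexity
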